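import Summits.Ventures.LatticeQCDFlow.Exactness.IMHWeightLevelMasses
import HarnessLib

/-!
# Finite second weight moment ⇒ every bounded observable of the flow sampler has finite `τ_int`

HONEST FRAMING: exact (Metropolis-corrected) sampling algorithms for lattice gauge theory;
figures of merit are autocorrelation/cost numbers at stated couplings and volumes; no
continuum-physics claim.  (SCALAR calibration rung S0-A: not a gauge result.)

Venture `LatticeQCDFlow` (cell pub-lqcd), topic `Exactness`; FANOUT row 2 (`s0-phi4`, FLOW arm).
NEW WORK of the cell, the first half of a dichotomy linking the cell's two figures of merit
(effective sample size of the importance weights; integrated autocorrelation time of the exact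
chain): if the importance weight `b = w/q` has a finite SECOND MOMENT under the model,
`W₂ = ∫ b w dμ = E_q[b²] < ∞` (equivalently the Kish effective-sample-size fraction `Z²/W₂` of
i.i.d. model draws is positive), then EVERY bounded centred observable has a summable
autocovariance series along the exact flow sampler, with an explicit bound.  Composes the closed
form of `IMHTauIntExact.lean` (`Σ_{k≥1} C(k) = I + J`) with `IMHWeightLevelMasses.lean`.  Nothing
is cited as a fact; the bounded-weight case (`b ≤ W Z`: uniform ergodicity, Mengersen–Tweedie
1996 NAMED ONLY; the tree's `FlowSamplerAutocorrelation.lean` gives `τ_int ≤ W − ½`) is extended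
here to unbounded, square-integrable weights, where geometric ergodicity fails.

## What is proved (`w, q > 0` measurable integrable, `∫ q = 1`, `Z = ∫ w`, `b = w/q`,
`λ = rejCurve`, `M(v) = ∫ min(w, v q) dμ`, `W₂ = ∫ b w dμ < ∞`; `g` measurable, `|g| ≤ B`,
CENTRED `∫ g w dμ = 0`; `C(k) = ∫ g (Kᵏ g) w dμ`; any `v₀ > 0`)

* **`levelFunctional_le`** — `I = ∫_{u>0} G²/(u(1−λ))² du` is finite, `I ≤ B² v₀ + B² Z W₂/M(v₀)²`;
* **`stickFunctional_le`** — `J = ∫ g² w λ(b)/(1−λ(b)) dμ` is finite, `J ≤ B² (W₂ + v₀ Z)/M(v₀)`;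
* **`hasSum_autocov_le_of_weightMoment`**, **`summable_autocov_of_weightMoment`** — the
  autocovariance series is summable with `Σ_{k≥1} C(k) ≤ B² (v₀ + Z W₂/M(v₀)² + (W₂ + v₀ Z)/M(v₀))`;
* **`imhOp_tauInt_le_of_weightMoment`** — on `Scoring.tauInt`:
  `τ_int(g) ≤ ½ + B² (v₀ + Z W₂/M(v₀)² + (W₂ + v₀ Z)/M(v₀)) / ∫ g² w dμ`
  (at `v₀ = Z`: `M(Z) = Z(1 − TV(q, w/Z))`, a polynomial in `W₂/Z²` and `1/(1 − TV)`).

The converse half (`W₂ = ∞` ⇒ an indicator observable with a non-summable series) and the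
lattice instances are left to `Exactness/IMHTauIntInfiniteOfWeightMoment.lean`.
NOT CLAIMED: HMC / local Metropolis; unbounded observables; any number for a trained network.
-/

namespace Summit.Ventures.LatticeQCDFlow.Exactness

open Real MeasureTheory Filter Set Topology
open Summit.Ventures.LatticeQCDFlow.Scoring

variable {X : Type*} [MeasurableSpace X] {μ : Measure X} {w q : X → ℝ}

variable [SFinite μ]

/-! ## The two weight functionals under a finite second moment -/

/-- **THE LEVEL FUNCTIONAL IS FINITE**: for a bounded centred observable and every `v₀ > 0`,
`u ↦ G(u)²/(u(1−λ(u)))²` is integrable on `(0, ∞)` and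
`∫_{u>0} G²/(u(1−λ))² du ≤ B² v₀ + B² Z W₂ / M(v₀)²`
(`(0, v₀]`: `|G| ≤ B Π(u⁻) ≤ B M(u)`; `(v₀, ∞)`: `M(u) ≥ M(v₀)`, `|G| ≤ B Π̄`, `∫ Π̄² ≤ Z W₂`). -/
theorem levelFunctional_le (hw0 : ∀ t, 0 < w t) (hwm : Measurable w) (hwi : Integrable w μ)
    (hq0 : ∀ t, 0 < q t) (hqm : Measurable q) (hqi : Integrable q μ) (hq1 : ∫ z, q z ∂μ = 1)
    (hW₂ : Integrable (fun x => w x / q x * w x) μ) {g : X → ℝ} (hgm : Measurable g) {B : ℝ}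
    (hgb : ∀ t, |g t| ≤ B) (hg0 : ∫ x, g x * w x ∂μ = 0) {v₀ : ℝ} (hv₀ : 0 < v₀) :
    IntegrableOn (fun u : ℝ => (∫ x, (if w x / q x < u then g x * w x else 0) ∂μ) ^ 2
        / (u * (1 - rejCurve μ w q u)) ^ 2) (Ioi 0)
    ∧ (∫ u in Ioi (0:ℝ), (∫ x, (if w x / q x < u then g x * w x else 0) ∂μ) ^ 2
        / (u * (1 - rejCurve μ w q u)) ^ 2)
      ≤ B ^ 2 * v₀ + B ^ 2 * ((∫ x, w x ∂μ) * ∫ x, w x / q x * w x ∂μ)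
          / (∫ z, min (w z) (v₀ * q z) ∂μ) ^ 2 := by
  set Z : ℝ := ∫ x, w x ∂μ with hZ
  set W₂ : ℝ := ∫ x, w x / q x * w x ∂μ with hW
  set m₀ : ℝ := ∫ z, min (w z) (v₀ * q z) ∂μ with hm
  set G : ℝ → ℝ := fun u => ∫ x, (if w x / q x < u then g x * w x else 0) ∂μ with hG
  set P : ℝ → ℝ := fun u => ∫ x, (if u ≤ w x / q x then w x else 0) ∂μ with hP
  have hm₀ : 0 < m₀ := clip_pos hw0 hwm hq0 hqm hqi hq1 hv₀
  have hB : 0 ≤ B ^ 2 := sq_nonneg _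
  obtain ⟨-, -, hP2i, hP2le⟩ := integral_upperMass_sq_le hw0 hwm hwi hq0 hqm hW₂
  have hmeas : Measurable fun u : ℝ => G u ^ 2 / (u * (1 - rejCurve μ w q u)) ^ 2 :=
    ((measurable_levelFun hwm hqm hgm).pow_const 2).div
      ((measurable_id.mul (measurable_const.sub (measurable_rejCurve hwm hqm))).pow_const 2)
  -- pointwise bounds on `(0, ∞)`
  have hM : ∀ u, 0 < u → u * (1 - rejCurve μ w q u) = ∫ z, min (w z) (u * q z) ∂μ :=
    fun u hu => mul_one_sub_rejCurve hw0 hwm hq0 hqm hqi hq1 hu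
  have hlow : ∀ u, 0 < u → G u ^ 2 / (u * (1 - rejCurve μ w q u)) ^ 2 ≤ B ^ 2 := by
    intro u hu
    have hMu : 0 < ∫ z, min (w z) (u * q z) ∂μ := clip_pos hw0 hwm hq0 hqm hqi hq1 hu
    have hP0 : 0 ≤ massBelow μ w q u := (massBelow_bounds hw0 hwm hwi hqm u).1
    have hPM : massBelow μ w q u ≤ ∫ z, min (w z) (u * q z) ∂μ :=
      (clip_le hw0 hwm hwi hq0 hqm hu.le).2
    have h1 : |G u| ≤ B * massBelow μ w q u := abs_levelFun_le hw0 hwm hwi hqm hgb u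
    have h2 : G u ^ 2 ≤ B ^ 2 * (∫ z, min (w z) (u * q z) ∂μ) ^ 2 := by
      calc G u ^ 2 ≤ (B * massBelow μ w q u) ^ 2 := by
            rw [← sq_abs]; exact pow_le_pow_left₀ (abs_nonneg _) h1 2
        _ = B ^ 2 * massBelow μ w q u ^ 2 := by ring
        _ ≤ B ^ 2 * (∫ z, min (w z) (u * q z) ∂μ) ^ 2 :=
            mul_le_mul_of_nonneg_left (pow_le_pow_left₀ hP0 hPM 2) (sq_nonneg _)
    rw [hM u hu, div_le_iff₀ (pow_pos hMu 2)]
    exact h2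
  have hhigh : ∀ u, v₀ < u → G u ^ 2 / (u * (1 - rejCurve μ w q u)) ^ 2 ≤ B ^ 2 / m₀ ^ 2 * P u ^ 2 := by
    intro u hu
    have hu0 : 0 < u := hv₀.trans hu
    have hMu : m₀ ≤ ∫ z, min (w z) (u * q z) ∂μ := clip_mono hw0 hwm hwi hq0 hqm hv₀.le hu.le
    have h1 : |G u| ≤ B * P u := abs_levelFun_le_upperMass hw0 hwm hwi hqm hgm hgb hg0 u
    have h2 : G u ^ 2 ≤ (B * P u) ^ 2 := by
      rw [← sq_abs]; exact pow_le_pow_left₀ (abs_nonneg _) h1 2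
    rw [hM u hu0]
    calc G u ^ 2 / (∫ z, min (w z) (u * q z) ∂μ) ^ 2 ≤ (B * P u) ^ 2 / m₀ ^ 2 := by
          refine div_le_div₀ (sq_nonneg _) h2 (pow_pos hm₀ 2) (pow_le_pow_left₀ hm₀.le hMu 2)
      _ = B ^ 2 / m₀ ^ 2 * P u ^ 2 := by ring
  -- integrability on `(0, v₀] ∪ (v₀, ∞)`
  have hI1 : IntegrableOn (fun u : ℝ => G u ^ 2 / (u * (1 - rejCurve μ w q u)) ^ 2) (Ioc 0 v₀) := by
    refine Integrable.mono' (integrableOn_const (C := B ^ 2) (measure_Ioc_lt_top.ne))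
      hmeas.aestronglyMeasurable ?_
    refine (ae_restrict_iff' measurableSet_Ioc).2 (Eventually.of_forall fun u hu => ?_)
    rw [Real.norm_eq_abs, abs_of_nonneg (div_nonneg (sq_nonneg _) (sq_nonneg _))]
    exact hlow u hu.1
  have hI2 : IntegrableOn (fun u : ℝ => G u ^ 2 / (u * (1 - rejCurve μ w q u)) ^ 2) (Ioi v₀) := by
    refine Integrable.mono' ((hP2i.mono_set (Ioi_subset_Ioi hv₀.le)).const_mul (B ^ 2 / m₀ ^ 2))
      hmeas.aestronglyMeasurable ?_
    refine (ae_restrict_iff' measurableSet_Ioi).2 (Eventually.of_forall fun u hu => ?_)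
    rw [Real.norm_eq_abs, abs_of_nonneg (div_nonneg (sq_nonneg _) (sq_nonneg _))]
    exact hhigh u hu
  have hunion : Ioc 0 v₀ ∪ Ioi v₀ = Ioi 0 := Ioc_union_Ioi_eq_Ioi hv₀.le
  refine ⟨by rw [← hunion]; exact hI1.union hI2, ?_⟩
  have hdisj : Disjoint (Ioc 0 v₀) (Ioi v₀) :=
    Set.disjoint_left.2 fun u hu hu' => (not_lt.2 hu.2) hu'
  rw [← hunion, setIntegral_union hdisj measurableSet_Ioi hI1 hI2]
  have e1 : ∫ u in Ioc 0 v₀, G u ^ 2 / (u * (1 - rejCurve μ w q u)) ^ 2 ≤ B ^ 2 * v₀ := by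
    calc ∫ u in Ioc 0 v₀, G u ^ 2 / (u * (1 - rejCurve μ w q u)) ^ 2
        ≤ ∫ u in Ioc 0 v₀, B ^ 2 := by
          refine setIntegral_mono_on hI1 (integrableOn_const (measure_Ioc_lt_top.ne))
            measurableSet_Ioc fun u hu => hlow u hu.1
      _ = B ^ 2 * v₀ := by
          rw [setIntegral_const, Real.volume_real_Ioc_of_le hv₀.le, sub_zero, smul_eq_mul, mul_comm]
  have e2 : ∫ u in Ioi v₀, G u ^ 2 / (u * (1 - rejCurve μ w q u)) ^ 2 ≤ B ^ 2 * (Z * W₂) / m₀ ^ 2 := by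
    calc ∫ u in Ioi v₀, G u ^ 2 / (u * (1 - rejCurve μ w q u)) ^ 2
        ≤ ∫ u in Ioi v₀, B ^ 2 / m₀ ^ 2 * P u ^ 2 :=
          setIntegral_mono_on hI2 ((hP2i.mono_set (Ioi_subset_Ioi hv₀.le)).const_mul _)
            measurableSet_Ioi fun u hu => hhigh u hu
      _ = B ^ 2 / m₀ ^ 2 * ∫ u in Ioi v₀, P u ^ 2 := integral_const_mul _ _
      _ ≤ B ^ 2 / m₀ ^ 2 * ∫ u in Ioi (0:ℝ), P u ^ 2 := by
          refine mul_le_mul_of_nonneg_left (setIntegral_mono_set hP2i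
            (Eventually.of_forall fun u => sq_nonneg _) (Eventually.of_forall (Ioi_subset_Ioi hv₀.le)))
            (div_nonneg hB (sq_nonneg _))
      _ ≤ B ^ 2 / m₀ ^ 2 * (Z * W₂) := mul_le_mul_of_nonneg_left hP2le (div_nonneg hB (sq_nonneg _))
      _ = B ^ 2 * (Z * W₂) / m₀ ^ 2 := by ring
  linarith

/-- **THE STICKING FUNCTIONAL IS FINITE**: for a bounded observable and every `v₀ > 0`,
`g² w λ(b)/(1−λ(b))` is integrable and `∫ g² w λ(b)/(1−λ(b)) dμ ≤ B² (W₂ + v₀ Z)/M(v₀)`. -/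
theorem stickFunctional_le (hw0 : ∀ t, 0 < w t) (hwm : Measurable w) (hwi : Integrable w μ)
    (hq0 : ∀ t, 0 < q t) (hqm : Measurable q) (hqi : Integrable q μ) (hq1 : ∫ z, q z ∂μ = 1)
    (hW₂ : Integrable (fun x => w x / q x * w x) μ) {g : X → ℝ} (hgm : Measurable g) {B : ℝ}
    (hgb : ∀ t, |g t| ≤ B) {v₀ : ℝ} (hv₀ : 0 < v₀) :
    Integrable (fun x => g x ^ 2 * w x
        * (rejCurve μ w q (w x / q x) / (1 - rejCurve μ w q (w x / q x)))) μ
    ∧ (∫ x, g x ^ 2 * w x * (rejCurve μ w q (w x / q x) / (1 - rejCurve μ w q (w x / q x))) ∂μ)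
      ≤ B ^ 2 * ((∫ x, w x / q x * w x ∂μ) + v₀ * ∫ x, w x ∂μ)
          / ∫ z, min (w z) (v₀ * q z) ∂μ := by
  set m₀ : ℝ := ∫ z, min (w z) (v₀ * q z) ∂μ with hm
  have hm₀ : 0 < m₀ := clip_pos hw0 hwm hq0 hqm hqi hq1 hv₀
  have hb0 : ∀ x, 0 < w x / q x := fun x => div_pos (hw0 x) (hq0 x)
  have hbm : Measurable fun x => w x / q x := hwm.div hqm
  have hB : 0 ≤ B ^ 2 := sq_nonneg _
  have hg2 : ∀ x, g x ^ 2 ≤ B ^ 2 := fun x => by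
    rw [← sq_abs]; exact pow_le_pow_left₀ (abs_nonneg _) (hgb x) 2
  have hodds : ∀ x, 0 ≤ rejCurve μ w q (w x / q x) / (1 - rejCurve μ w q (w x / q x))
      ∧ rejCurve μ w q (w x / q x) / (1 - rejCurve μ w q (w x / q x)) ≤ (w x / q x + v₀) / m₀ :=
    fun x => ⟨div_nonneg (rejCurve_bounds hw0 hq0 hqi (hb0 x) (μ := μ)).1
      (sub_nonneg.2 (rejCurve_lt_one hw0 hwm hq0 hqm hqi hq1 (hb0 x)).le),
      rejOdds_le hw0 hwm hwi hq0 hqm hqi hq1 hv₀ (hb0 x)⟩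
  -- dominating function `B² (b w + v₀ w)/m₀`
  have hdom : Integrable (fun x => B ^ 2 / m₀ * (w x / q x * w x + v₀ * w x)) μ :=
    (hW₂.add (hwi.const_mul v₀)).const_mul _
  have hpt : ∀ x, g x ^ 2 * w x * (rejCurve μ w q (w x / q x) / (1 - rejCurve μ w q (w x / q x)))
      ≤ B ^ 2 / m₀ * (w x / q x * w x + v₀ * w x) := by
    intro x
    obtain ⟨h0, h1⟩ := hodds x
    calc g x ^ 2 * w x * (rejCurve μ w q (w x / q x) / (1 - rejCurve μ w q (w x / q x)))
        ≤ B ^ 2 * w x * ((w x / q x + v₀) / m₀) :=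
          mul_le_mul (mul_le_mul_of_nonneg_right (hg2 x) (hw0 x).le) h1 h0
            (mul_nonneg hB (hw0 x).le)
      _ = B ^ 2 / m₀ * (w x / q x * w x + v₀ * w x) := by
          field_simp
  have hnn : ∀ x, 0 ≤ g x ^ 2 * w x
      * (rejCurve μ w q (w x / q x) / (1 - rejCurve μ w q (w x / q x))) :=
    fun x => mul_nonneg (mul_nonneg (sq_nonneg _) (hw0 x).le) (hodds x).1
  have hmeas : Measurable fun x => g x ^ 2 * w x
      * (rejCurve μ w q (w x / q x) / (1 - rejCurve μ w q (w x / q x))) :=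
    ((hgm.pow_const 2).mul hwm).mul (((measurable_rejCurve hwm hqm).comp hbm).div
      (measurable_const.sub ((measurable_rejCurve hwm hqm).comp hbm)))
  have hint : Integrable (fun x => g x ^ 2 * w x
      * (rejCurve μ w q (w x / q x) / (1 - rejCurve μ w q (w x / q x)))) μ := by
    refine Integrable.mono' hdom hmeas.aestronglyMeasurable (Eventually.of_forall fun x => ?_)
    rw [Real.norm_eq_abs, abs_of_nonneg (hnn x)]
    exact hpt x
  refine ⟨hint, ?_⟩
  calc ∫ x, g x ^ 2 * w x * (rejCurve μ w q (w x / q x) / (1 - rejCurve μ w q (w x / q x))) ∂μ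
      ≤ ∫ x, B ^ 2 / m₀ * (w x / q x * w x + v₀ * w x) ∂μ := integral_mono hint hdom hpt
    _ = B ^ 2 * ((∫ x, w x / q x * w x ∂μ) + v₀ * ∫ x, w x ∂μ) / m₀ := by
        rw [integral_const_mul, integral_add hW₂ (hwi.const_mul v₀), integral_const_mul]
        field_simp

/-! ## Summability and the bound -/

/-- **FINITE SECOND WEIGHT MOMENT ⇒ SUMMABLE AUTOCOVARIANCES FOR EVERY BOUNDED OBSERVABLE.**
`w, q > 0` measurable integrable, `∫ q = 1`, and `∫ b w dμ < ∞` (`b = w/q`; equivalently the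
importance weights have a finite second moment under the model, i.e. a positive Kish
effective-sample-size fraction).  Then for every bounded measurable CENTRED `g` the series
`Σ_k ∫ g (K^{k+1} g) w dμ` is summable, with sum
`≤ B² (v₀ + Z W₂/M(v₀)² + (W₂ + v₀ Z)/M(v₀))` for every `v₀ > 0`. -/
theorem hasSum_autocov_le_of_weightMoment (hw0 : ∀ t, 0 < w t) (hwm : Measurable w)
    (hwi : Integrable w μ) (hq0 : ∀ t, 0 < q t) (hqm : Measurable q) (hqi : Integrable q μ)
    (hq1 : ∫ z, q z ∂μ = 1) (hW₂ : Integrable (fun x => w x / q x * w x) μ) {g : X → ℝ}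
    (hgm : Measurable g) {B : ℝ} (hgb : ∀ t, |g t| ≤ B) (hg0 : ∫ x, g x * w x ∂μ = 0)
    {v₀ : ℝ} (hv₀ : 0 < v₀) :
    ∃ s : ℝ, HasSum (fun k => ∫ x, g x * ((imhOp μ w q)^[k + 1] g) x * w x ∂μ) s
      ∧ s ≤ B ^ 2 * v₀ + B ^ 2 * ((∫ x, w x ∂μ) * ∫ x, w x / q x * w x ∂μ)
              / (∫ z, min (w z) (v₀ * q z) ∂μ) ^ 2
          + B ^ 2 * ((∫ x, w x / q x * w x ∂μ) + v₀ * ∫ x, w x ∂μ)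
              / ∫ z, min (w z) (v₀ * q z) ∂μ := by
  obtain ⟨hI, hIle⟩ := levelFunctional_le hw0 hwm hwi hq0 hqm hqi hq1 hW₂ hgm hgb hg0 hv₀
  obtain ⟨hJ, hJle⟩ := stickFunctional_le hw0 hwm hwi hq0 hqm hqi hq1 hW₂ hgm hgb hv₀
  exact ⟨_, hasSum_autocov_layerCake hw0 hwm hwi hq0 hqm hqi hq1 hgm hgb hI hJ, by linarith⟩

/-- **Summability** of the autocovariance series of every bounded centred observable under a
finite second weight moment. -/
theorem summable_autocov_of_weightMoment (hw0 : ∀ t, 0 < w t) (hwm : Measurable w)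
    (hwi : Integrable w μ) (hq0 : ∀ t, 0 < q t) (hqm : Measurable q) (hqi : Integrable q μ)
    (hq1 : ∫ z, q z ∂μ = 1) (hW₂ : Integrable (fun x => w x / q x * w x) μ) {g : X → ℝ}
    (hgm : Measurable g) {B : ℝ} (hgb : ∀ t, |g t| ≤ B) (hg0 : ∫ x, g x * w x ∂μ = 0) :
    Summable fun k => ∫ x, g x * ((imhOp μ w q)^[k + 1] g) x * w x ∂μ := by
  obtain ⟨s, hs, -⟩ := hasSum_autocov_le_of_weightMoment hw0 hwm hwi hq0 hqm hqi hq1 hW₂ hgm hgb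
    hg0 one_pos
  exact hs.summable

/-- **THE `τ_int` BOUND**: under a finite second weight moment, for every bounded centred
observable and every `v₀ > 0`,
`τ_int(g) ≤ ½ + B² (v₀ + Z W₂/M(v₀)² + (W₂ + v₀ Z)/M(v₀)) / ∫ g² w dμ`
on the tree's `Scoring.tauInt` — finite however heavy the (square-integrable) weight tail. -/
theorem imhOp_tauInt_le_of_weightMoment (hw0 : ∀ t, 0 < w t) (hwm : Measurable w)
    (hwi : Integrable w μ) (hq0 : ∀ t, 0 < q t) (hqm : Measurable q) (hqi : Integrable q μ)
    (hq1 : ∫ z, q z ∂μ = 1) (hW₂ : Integrable (fun x => w x / q x * w x) μ) {g : X → ℝ}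
    (hgm : Measurable g) {B : ℝ} (hgb : ∀ t, |g t| ≤ B) (hg0 : ∫ x, g x * w x ∂μ = 0)
    {v₀ : ℝ} (hv₀ : 0 < v₀) :
    tauInt (fun k => (∫ x, g x * ((imhOp μ w q)^[k] g) x * w x ∂μ) / ∫ x, g x ^ 2 * w x ∂μ)
      ≤ 1 / 2 + (B ^ 2 * v₀ + B ^ 2 * ((∫ x, w x ∂μ) * ∫ x, w x / q x * w x ∂μ)
              / (∫ z, min (w z) (v₀ * q z) ∂μ) ^ 2
          + B ^ 2 * ((∫ x, w x / q x * w x ∂μ) + v₀ * ∫ x, w x ∂μ)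
              / ∫ z, min (w z) (v₀ * q z) ∂μ) / ∫ x, g x ^ 2 * w x ∂μ := by
  obtain ⟨s, hs, hle⟩ := hasSum_autocov_le_of_weightMoment hw0 hwm hwi hq0 hqm hqi hq1 hW₂ hgm
    hgb hg0 hv₀
  have hA0 : 0 ≤ ∫ x, g x ^ 2 * w x ∂μ := integral_nonneg fun x => mul_nonneg (sq_nonneg _) (hw0 x).le
  simp only [tauInt]
  rw [(hs.div_const (∫ x, g x ^ 2 * w x ∂μ)).tsum_eq]
  exact add_le_add le_rfl (div_le_div_of_nonneg_right hle hA0)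

end Summit.Ventures.LatticeQCDFlow.Exactness
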